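import Mathlib
import Summits.NavierStokesRegularity.NavierStokesRegularity.Theorems.FilamentSkeletonRssAnalyticStripStadiumDefs
import Summits.NavierStokesRegularity.NavierStokesRegularity.Theorems.FilamentSkeletonRssStadiumStripPropagation

/-!
# Route `FilamentSkeletonRss` · twin child cruxes `TangentSkeletonNearStraight` (stmt-28295) / `TangentSkeletonNearStraightL` (stmt-23320) ·
# shared registered stub `stub_stripPropagation : StripPropagation` — THE REGISTERED STUB FROM A QUARTER-WIDTH PER-FILAMENT CORE (Γ-asymptotics +
# quantifier packaging, done once, BY NAME)

The landed sixteenth-width text (`Theorems.StadiumStripPropagation.strip_propagation_sixteenth`, p823048) is «per-filament core at one Γ with an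
EXPLICIT bound» (`Theorems.StadiumStripCore.strip_core`) + «Γ-asymptotics of that bound + quantifier packaging».  The quarter-width programme
(hands leafhand-15, blueprint on 23320; remaining items R1-far / R3 / R4) will end in a quarter-width per-filament core of the same shape with SOME
explicit bound built from the contour lengths `L + h`, the kernel scales `h⁻¹, h⁻², h⁻³`, a plateau logarithm and the partner distance `d₀⁻¹`.  This file
does the second half ONCE for every such core: `stripPropagation_of_quarterCore` proves the registered stub statement `StripPropagation` (the
Theorems-side verbatim copy `Theorems.AnalyticStripStadium.StripPropagation`, p829841, definitionally the line's) from a quarter-width core whose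
bound is dominated by `A · T(Γ)` with the generous TEMPLATE
  `T(Γ) = (1 + |log(L + h)| + ((L + h)/h)²)/h + 1/d₀`,  `h = cs√Γ/4`, `L = Rb√(Γ log Γ)`, `d₀ = ρ√Γ`,
`A` any Γ-independent constant; the core may in addition assume `Γ ≥ 1`, `log Γ ≥ 1`, `h ≥ h₀`, `L ≥ L₀` for thresholds `h₀, L₀` of its choosing
(all plateau / log-conditions of `strip_core` type are of this form).  The asymptotics `Γ·T(Γ) ≤ C_T·√Γ·log Γ` is `template_le`.  So the by-name
closer of either twin is reduced to: (their explicit bound) `≤ A·T(Γ)` — algebra, no asymptotics — and `stub_stripPropagation := stripPropagation_of_quarterCore ⟨…⟩`.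

HONEST FRAMING: bookkeeping for a HYPOTHETICAL filament skeleton on the NEGATIVE side of a MODEL route; the quarter-width core is NOT proved here
(it is the open analytic content of the stub), so no stub of 28295 / 23320 is closed; nothing here bears on Navier–Stokes regularity or blow-up.
`--supports stmt-NavierStokesRegularity-28295`.
-/

set_option linter.dupNamespace false

noncomputable section

namespace Summit.NavierStokesRegularity.NavierStokesRegularity.Theorems.StadiumStripPropagationQuarter

open Set MeasureTheory Complex
open scoped InnerProductSpace
open Literature.Analysis.FluidPDE
open Summit.NavierStokesRegularity.NavierStokesRegularity.Theorems.AnalyticStripStadium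
open Summit.NavierStokesRegularity.NavierStokesRegularity.Theorems.StadiumStripPropagation

/-! ## §1  The template asymptotics -/

/-- **The template asymptotics.**  With `h = cs√Γ/4 ≥ 1`, `L = Rb√(Γ log Γ)`, `d₀ = ρ√Γ`, `log Γ ≥ 1`:
`(1 + |log(L+h)| + ((L+h)/h)²)/h + 1/d₀ ≤ C_T · log Γ/√Γ`, `C_T = 4(7/2 + Rb + cs/4 + 32Rb²/cs²)/cs + 1/ρ`. [folklore] -/
theorem template_le {cs ρ Rb Γ : ℝ} (hcs : 0 < cs) (hρ : 0 < ρ) (hRb : 0 ≤ Rb) (hΓ1 : 1 ≤ Γ) (hℓ1 : 1 ≤ Real.log Γ)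
    (hh1 : 1 ≤ cs * √Γ / 4) :
    (1 + |Real.log (Rb * √(Γ * Real.log Γ) + cs * √Γ / 4)| +
        ((Rb * √(Γ * Real.log Γ) + cs * √Γ / 4) / (cs * √Γ / 4)) ^ 2) / (cs * √Γ / 4) + 1 / (ρ * √Γ) ≤
      (4 * (7 / 2 + Rb + cs / 4 + 32 * Rb ^ 2 / cs ^ 2) / cs + 1 / ρ) * Real.log Γ / √Γ := by
  obtain ⟨hr1, -, -, hsℓ, hs1, hsplit⟩ := gamma_facts hΓ1 hℓ1
  have hΓ0 : 0 ≤ Γ := by linarith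
  set r : ℝ := √Γ with hr
  set s : ℝ := √(Real.log Γ) with hs
  set ℓ : ℝ := Real.log Γ with hℓ
  have hr0 : 0 < r := by linarith
  have hs2 : s ^ 2 = ℓ := by rw [hs]; exact Real.sq_sqrt (by linarith)
  rw [hsplit]
  -- `L + h = r (Rb s + cs/4)`
  set w : ℝ := Rb * s + cs / 4 with hw
  have hw0 : 0 < w := by rw [hw]; positivity
  have hLh : Rb * (r * s) + cs * r / 4 = r * w := by rw [hw]; ring
  rw [hLh]
  have hLh1 : 1 ≤ r * w := by
    have h0 : 0 ≤ r * (Rb * s) := mul_nonneg hr0.le (mul_nonneg hRb (by linarith))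
    have : cs * r / 4 ≤ r * w := by rw [hw]; nlinarith
    linarith
  -- the logarithm
  have hlog : |Real.log (r * w)| ≤ (1 / 2 + Rb + cs / 4) * ℓ := by
    rw [abs_of_nonneg (Real.log_nonneg hLh1), Real.log_mul hr0.ne' hw0.ne', hr, Real.log_sqrt hΓ0]
    have h1 : Real.log w ≤ w := (Real.log_le_sub_one_of_pos hw0).trans (by linarith)
    have h2 : w ≤ (Rb + cs / 4) * ℓ := by
      rw [hw]; nlinarith
    rw [← hℓ]; nlinarith
  -- the squared length ratio
  have hratio : (r * w / (cs * r / 4)) ^ 2 ≤ (2 + 32 * Rb ^ 2 / cs ^ 2) * ℓ := by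
    have he : r * w / (cs * r / 4) = 1 + 4 * Rb * s / cs := by
      rw [hw]; field_simp; ring
    rw [he]
    have hsq : (1 + 4 * Rb * s / cs) ^ 2 ≤ 2 + 2 * (4 * Rb * s / cs) ^ 2 := by
      nlinarith [sq_nonneg (1 - 4 * Rb * s / cs)]
    have h3 : 2 * (4 * Rb * s / cs) ^ 2 = 32 * Rb ^ 2 / cs ^ 2 * ℓ := by
      rw [← hs2]; field_simp; ring
    rw [h3] at hsq
    have h4 : 0 ≤ 32 * Rb ^ 2 / cs ^ 2 := by positivity
    nlinarith
  -- numerator and assembly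
  have hnum : 1 + |Real.log (r * w)| + (r * w / (cs * r / 4)) ^ 2 ≤ (7 / 2 + Rb + cs / 4 + 32 * Rb ^ 2 / cs ^ 2) * ℓ := by
    nlinarith
  have hh0 : 0 < cs * r / 4 := by positivity
  have hK0 : 0 ≤ 7 / 2 + Rb + cs / 4 + 32 * Rb ^ 2 / cs ^ 2 := by positivity
  have hfirst : (1 + |Real.log (r * w)| + (r * w / (cs * r / 4)) ^ 2) / (cs * r / 4) ≤
      (4 * (7 / 2 + Rb + cs / 4 + 32 * Rb ^ 2 / cs ^ 2) / cs) * ℓ / r := by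
    rw [div_le_iff₀ hh0]
    calc 1 + |Real.log (r * w)| + (r * w / (cs * r / 4)) ^ 2 ≤ (7 / 2 + Rb + cs / 4 + 32 * Rb ^ 2 / cs ^ 2) * ℓ := hnum
      _ = (4 * (7 / 2 + Rb + cs / 4 + 32 * Rb ^ 2 / cs ^ 2) / cs) * ℓ / r * (cs * r / 4) := by
          field_simp
  have hsecond : 1 / (ρ * r) ≤ (1 / ρ) * ℓ / r := by
    rw [show (1 / ρ) * ℓ / r = ℓ / (ρ * r) by field_simp]
    gcongr
  calc (1 + |Real.log (r * w)| + (r * w / (cs * r / 4)) ^ 2) / (cs * r / 4) + 1 / (ρ * r)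
      ≤ (4 * (7 / 2 + Rb + cs / 4 + 32 * Rb ^ 2 / cs ^ 2) / cs) * ℓ / r + (1 / ρ) * ℓ / r := add_le_add hfirst hsecond
    _ = (4 * (7 / 2 + Rb + cs / 4 + 32 * Rb ^ 2 / cs ^ 2) / cs + 1 / ρ) * ℓ / r := by ring

/-- The template is nonnegative. [folklore] -/
theorem template_nonneg {cs ρ Rb Γ : ℝ} (hcs : 0 < cs) (hρ : 0 < ρ) (hΓ : 0 < Γ) :
    0 ≤ (1 + |Real.log (Rb * √(Γ * Real.log Γ) + cs * √Γ / 4)| +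
        ((Rb * √(Γ * Real.log Γ) + cs * √Γ / 4) / (cs * √Γ / 4)) ^ 2) / (cs * √Γ / 4) + 1 / (ρ * √Γ) := by
  have : 0 < √Γ := Real.sqrt_pos.mpr hΓ
  positivity

/-- Thresholds: for `Γ ≥ Γ₀(cs, Rb, h₀, L₀) = max(e, (4·max(h₀,1)/cs)², (max(L₀,0)/Rb)²)` one has `Γ ≥ 1`, `log Γ ≥ 1`, `h ≥ max(h₀, 1)`, `L ≥ L₀`.
[folklore] -/
theorem thresholds {cs Rb h₀ L₀ Γ : ℝ} (hcs : 0 < cs) (hRb : 0 < Rb)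
    (hΓ : max (Real.exp 1) (max ((4 * max h₀ 1 / cs) ^ 2) ((max L₀ 0 / Rb) ^ 2)) ≤ Γ) :
    1 ≤ Γ ∧ 1 ≤ Real.log Γ ∧ h₀ ≤ cs * √Γ / 4 ∧ 1 ≤ cs * √Γ / 4 ∧ L₀ ≤ Rb * √(Γ * Real.log Γ) := by
  have hΓe : Real.exp 1 ≤ Γ := le_trans (le_max_left _ _) hΓ
  have hΓh : (4 * max h₀ 1 / cs) ^ 2 ≤ Γ := le_trans (le_trans (le_max_left _ _) (le_max_right _ _)) hΓ
  have hΓL : (max L₀ 0 / Rb) ^ 2 ≤ Γ := le_trans (le_trans (le_max_right _ _) (le_max_right _ _)) hΓ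
  have hΓpos : 0 < Γ := lt_of_lt_of_le (Real.exp_pos 1) hΓe
  have hΓ1 : 1 ≤ Γ := by
    have h1 : (1:ℝ) + 1 ≤ Real.exp 1 := Real.add_one_le_exp 1
    linarith
  have hℓ1 : 1 ≤ Real.log Γ := by
    rw [Real.le_log_iff_exp_le hΓpos]; exact hΓe
  have hrh : 4 * max h₀ 1 / cs ≤ √Γ := by
    have := Real.sqrt_le_sqrt hΓh
    rwa [Real.sqrt_sq (by positivity)] at this
  have hrL : max L₀ 0 / Rb ≤ √Γ := by
    have := Real.sqrt_le_sqrt hΓL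
    rwa [Real.sqrt_sq (by positivity)] at this
  have hh : max h₀ 1 ≤ cs * √Γ / 4 := by
    rw [div_le_iff₀ hcs] at hrh; linarith
  have hL : max L₀ 0 ≤ Rb * √(Γ * Real.log Γ) := by
    rw [div_le_iff₀ hRb] at hrL
    obtain ⟨hr1, -, -, -, hs1, hsplit⟩ := gamma_facts hΓ1 hℓ1
    rw [hsplit]
    have : Rb * √Γ ≤ Rb * (√Γ * √(Real.log Γ)) := by
      have h0 : 0 ≤ Rb * √Γ := by positivity
      nlinarith
    linarith
  exact ⟨hΓ1, hℓ1, le_trans (le_max_left _ _) hh, le_trans (le_max_right _ _) hh, le_trans (le_max_left _ _) hL⟩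

/-! ## §2  The registered stub from a quarter-width core -/

/-- **`StripPropagation` from a quarter-width per-filament core (template form).**  HYPOTHESIS `core`: for every admissible constant tuple there are
a Γ-independent `A` and thresholds `h₀, L₀` such that, for every `Γ ≥ 1` with `log Γ ≥ 1`, `h = cs√Γ/4 ≥ h₀`, `L = Rb√(Γ log Γ) ≥ L₀`, every datum
satisfying the stub's hypotheses (verbatim, predicates δ-unfolded) and every filament `j`, the field `τ ↦ u X (X j τ)` has a holomorphic continuation to
the QUARTER-width stadium agreeing with it on the real trace and bounded by `(∑ₖ |Γγₖ/4π|) · (A · T(Γ))`.  CONCLUSION: the registered stub statement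
(Theorems-side verbatim copy), with `Cu = Nθ₀⁻¹·max(A,0)·C_T/4π + 1` and `Γ₀` from `thresholds`. [folklore] -/
theorem stripPropagation_of_quarterCore
    (core : ∀ (N : ℕ) (ρ K Λ Rb cg θ₀ KA cs : ℝ), 0 < N → 0 < ρ → 0 < Λ → 0 < Rb → Rb ≤ 1/2 → 0 < cg → 0 < θ₀ → 0 < KA →
      0 < cs → 8 * cs ≤ ρ →
      ∃ (A h₀ L₀ : ℝ), ∀ Γ : ℝ, 1 ≤ Γ → 1 ≤ Real.log Γ → h₀ ≤ cs * √Γ / 4 → L₀ ≤ Rb * √(Γ * Real.log Γ) →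
      ∀ (γ : Fin N → ℝ) (X : Fin N → ℝ → EuclideanSpace ℝ (Fin 3)) (c : Fin N → ℝ) (Aa : Fin N → ℝ → ℝ)
        (u : (Fin N → ℝ → EuclideanSpace ℝ (Fin 3)) → EuclideanSpace ℝ (Fin 3) → EuclideanSpace ℝ (Fin 3)),
        (∀ Z y, u Z y = ∑ k, (Γ*γ k/(4*Real.pi))•∫ σ:ℝ, ((‖y-Z k σ‖^2+Real.exp (-(1+Real.eulerMascheroniConstant-Real.log 2))*Aa k σ)^(3/2:ℝ))⁻¹•cross (deriv (Z k) σ) (y-Z k σ)) →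
        (∀ j, |γ j| ≤ θ₀⁻¹) →
        (∀ j, ContDiff ℝ 2 (X j) ∧ (∀ τ, ‖deriv (X j) τ‖ = 1) ∧ (∀ τ, ‖iteratedDeriv 2 (X j) τ‖ * √Γ ≤ K) ∧
          ∀ τ σ, ‖deriv (X j) τ - deriv (X j) σ‖ ≤ Rb) →
        (∀ j k, j ≠ k → ∀ τ σ, ρ * √Γ ≤ ‖X j τ - X k σ‖) →
        (∀ j τ σ, ρ * √Γ ≤ |τ - σ| → cg * ρ * √Γ ≤ ‖X j τ - X j σ‖) →
        (∀ j, Differentiable ℝ (Aa j) ∧ (∀ τ, Λ⁻¹ ≤ Aa j τ) ∧ ∀ τ, Aa j τ ≤ KA * (1 + Γ + ‖X j τ‖ ^ 2)) →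
        (∀ j, ∃ F : ℂ → (Fin 3 → ℂ),
          DifferentiableOn ℂ F {z : ℂ | |z.im| < cs * √Γ ∧ |z.re - c j| < Rb * √(Γ * Real.log Γ) + cs * √Γ} ∧
          (∀ t : ℝ, (t : ℂ) ∈ {z : ℂ | |z.im| < cs * √Γ ∧ |z.re - c j| < Rb * √(Γ * Real.log Γ) + cs * √Γ} →
            F t = fun i => ((⟪X j t, EuclideanSpace.single i (1:ℝ)⟫_ℝ : ℝ) : ℂ)) ∧
          ∀ z ∈ {z : ℂ | |z.im| < cs * √Γ ∧ |z.re - c j| < Rb * √(Γ * Real.log Γ) + cs * √Γ}, ‖deriv F z‖ ≤ 2) →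
        (∀ j, ∃ G : ℂ → ℂ,
          DifferentiableOn ℂ G {z : ℂ | |z.im| < cs * √Γ ∧ |z.re - c j| < Rb * √(Γ * Real.log Γ) + cs * √Γ} ∧
          (∀ t : ℝ, (t : ℂ) ∈ {z : ℂ | |z.im| < cs * √Γ ∧ |z.re - c j| < Rb * √(Γ * Real.log Γ) + cs * √Γ} →
            G t = ((Aa j t : ℝ) : ℂ)) ∧
          ∀ z ∈ {z : ℂ | |z.im| < cs * √Γ ∧ |z.re - c j| < Rb * √(Γ * Real.log Γ) + cs * √Γ},
            Aa j z.re / 2 ≤ (G z).re ∧ ‖G z‖ ≤ 2 * Aa j z.re) →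
        ∀ j, ∃ U : ℂ → (Fin 3 → ℂ),
          DifferentiableOn ℂ U {z : ℂ | |z.im| < cs * √Γ / 4 ∧ |z.re - c j| < Rb * √(Γ * Real.log Γ) + cs * √Γ / 4} ∧
          (∀ t : ℝ, (t : ℂ) ∈ {z : ℂ | |z.im| < cs * √Γ / 4 ∧ |z.re - c j| < Rb * √(Γ * Real.log Γ) + cs * √Γ / 4} →
            U t = fun i => ((⟪u X (X j t), EuclideanSpace.single i (1:ℝ)⟫_ℝ : ℝ) : ℂ)) ∧
          ∀ z ∈ {z : ℂ | |z.im| < cs * √Γ / 4 ∧ |z.re - c j| < Rb * √(Γ * Real.log Γ) + cs * √Γ / 4},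
            ‖U z‖ ≤ (∑ k, |Γ * γ k / (4 * Real.pi)|) * (A *
              ((1 + |Real.log (Rb * √(Γ * Real.log Γ) + cs * √Γ / 4)| +
                ((Rb * √(Γ * Real.log Γ) + cs * √Γ / 4) / (cs * √Γ / 4)) ^ 2) / (cs * √Γ / 4) + 1 / (ρ * √Γ)))) :
    StripPropagation := by
  refine stripPropagation_iff.mpr ?_
  intro N ρ K Λ Rb cg θ₀ KA cs hN hρ hΛ hRb hRb2 hcg hθ hKA hcs h8
  obtain ⟨A, h₀, L₀, hcore⟩ := core N ρ K Λ Rb cg θ₀ KA cs hN hρ hΛ hRb hRb2 hcg hθ hKA hcs h8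
  -- constants
  set CT : ℝ := 4 * (7 / 2 + Rb + cs / 4 + 32 * Rb ^ 2 / cs ^ 2) / cs + 1 / ρ with hCT
  have hCT0 : 0 < CT := by positivity
  have hN' : (0:ℝ) < N := Nat.cast_pos.mpr hN
  set Cu : ℝ := (N : ℝ) * θ₀⁻¹ / (4 * Real.pi) * max A 0 * CT + 1 with hCu
  have hpre : 0 ≤ (N : ℝ) * θ₀⁻¹ / (4 * Real.pi) * max A 0 * CT := by
    have : 0 ≤ max A 0 := le_max_right _ _
    positivity
  have hCupos : 0 < Cu := by linarith
  refine ⟨Cu, max (Real.exp 1) (max ((4 * max h₀ 1 / cs) ^ 2) ((max L₀ 0 / Rb) ^ 2)), hCupos, ?_⟩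
  intro Γ hΓ γ X c Aa u hu hγ hX hsep hca hA hF hG j
  obtain ⟨hΓ1, hℓ1, hh₀, hh1, hL₀⟩ := thresholds hcs hRb hΓ
  have hΓpos : 0 < Γ := by linarith
  obtain ⟨U, hU1, hU2, hU3⟩ := hcore Γ hΓ1 hℓ1 hh₀ hL₀ γ X c Aa u hu hγ hX hsep hca hA hF hG j
  refine ⟨U, hU1, hU2, fun z hz => (hU3 z hz).trans ?_⟩
  -- the Γ-asymptotics
  have hS := coeff_sum_le (N := N) (γ := γ) (θ₀ := θ₀) hΓpos.le hγ
  have hS0 : 0 ≤ ∑ k, |Γ * γ k / (4 * Real.pi)| := Finset.sum_nonneg fun k _ => abs_nonneg _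
  have hT := template_le (Rb := Rb) hcs hρ hRb.le hΓ1 hℓ1 hh1
  have hT0 := template_nonneg (Rb := Rb) hcs hρ hΓpos
  set T : ℝ := (1 + |Real.log (Rb * √(Γ * Real.log Γ) + cs * √Γ / 4)| +
      ((Rb * √(Γ * Real.log Γ) + cs * √Γ / 4) / (cs * √Γ / 4)) ^ 2) / (cs * √Γ / 4) + 1 / (ρ * √Γ) with hTdef
  have hr0 : 0 < √Γ := Real.sqrt_pos.mpr hΓpos
  have hrr : √Γ * √Γ = Γ := Real.mul_self_sqrt hΓpos.le
  have hℓ0 : 0 ≤ Real.log Γ := by linarith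
  -- `A·T ≤ max(A,0)·C_T·log Γ/√Γ`
  have hAT : A * T ≤ max A 0 * (CT * Real.log Γ / √Γ) := by
    calc A * T ≤ max A 0 * T := mul_le_mul_of_nonneg_right (le_max_left _ _) hT0
      _ ≤ max A 0 * (CT * Real.log Γ / √Γ) := mul_le_mul_of_nonneg_left hT (le_max_right _ _)
  have hmain : (∑ k, |Γ * γ k / (4 * Real.pi)|) * (A * T) ≤
      (N * (Γ * θ₀⁻¹ / (4 * Real.pi))) * (max A 0 * (CT * Real.log Γ / √Γ)) := by
    have h0 : 0 ≤ max A 0 * (CT * Real.log Γ / √Γ) := by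
      have : 0 ≤ max A 0 := le_max_right _ _
      positivity
    calc (∑ k, |Γ * γ k / (4 * Real.pi)|) * (A * T) ≤ (∑ k, |Γ * γ k / (4 * Real.pi)|) * (max A 0 * (CT * Real.log Γ / √Γ)) :=
          mul_le_mul_of_nonneg_left hAT hS0
      _ ≤ (N * (Γ * θ₀⁻¹ / (4 * Real.pi))) * (max A 0 * (CT * Real.log Γ / √Γ)) := mul_le_mul_of_nonneg_right hS h0
  have heq : (N * (Γ * θ₀⁻¹ / (4 * Real.pi))) * (max A 0 * (CT * Real.log Γ / √Γ)) =
      ((N : ℝ) * θ₀⁻¹ / (4 * Real.pi) * max A 0 * CT) * √Γ * Real.log Γ := by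
    have h' : (N * ((√Γ * √Γ) * θ₀⁻¹ / (4 * Real.pi))) * (max A 0 * (CT * Real.log Γ / √Γ)) =
        ((N : ℝ) * θ₀⁻¹ / (4 * Real.pi) * max A 0 * CT) * √Γ * Real.log Γ := by
      field_simp
    rw [hrr] at h'
    exact h'
  have hlast : ((N : ℝ) * θ₀⁻¹ / (4 * Real.pi) * max A 0 * CT) * √Γ * Real.log Γ ≤ Cu * √Γ * Real.log Γ := by
    have : ((N : ℝ) * θ₀⁻¹ / (4 * Real.pi) * max A 0 * CT) ≤ Cu := by rw [hCu]; linarith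
    have h2 : 0 ≤ √Γ * Real.log Γ := by positivity
    nlinarith
  calc (∑ k, |Γ * γ k / (4 * Real.pi)|) * (A * T) ≤ (N * (Γ * θ₀⁻¹ / (4 * Real.pi))) * (max A 0 * (CT * Real.log Γ / √Γ)) := hmain
    _ = ((N : ℝ) * θ₀⁻¹ / (4 * Real.pi) * max A 0 * CT) * √Γ * Real.log Γ := heq
    _ ≤ Cu * √Γ * Real.log Γ := hlast

end Summit.NavierStokesRegularity.NavierStokesRegularity.Theorems.StadiumStripPropagationQuarter
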